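import Literature.NumberTheory.Automorphic.Liu2021.AppendixC.EtaleH1Tower
import HarnessLib

/-!
# [Liu 2021, §4.2] transport of a Galois eigen-relation from `(V_ℓ B)^∨` into `H¹_ét(A_∞)` along a homomorphism `A_K → B`

Topic `NumberTheory/Automorphic/Liu2021/AppendixC`; namespace `Literature.NumberTheory.Automorphic.Liu2021.AppendixC`, dot-notation on
the §4.2 datum `C : Sec42Data P5 isotropicAt` (`Glue.lean`) as in ★ `EtaleH1Tower.lean`.  THEOREMS ONLY (no definition, no named fact,
no instance, no `sorry`); inputs: ★ `EtaleH1Tower` (`Sec42Data.toTower`, `towerRep`, `towerRep_toTower`, `etaleH1Rep_apply`) and ★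
`TateAbelianFiniteSteps.rationalTateRep_rationalTateModuleMap` (the `Γ_E`-equivariance of `V_ℓ φ`).

## What is proved

For a small level `K`, an abelian variety `B` over `E` and a homomorphism `φ : A_K ⟶ B` (e.g. a Hecke-isotypic quotient of the
Albanese `A_K = Alb X_K`), pulling linear forms back along `V_ℓ φ` and pushing into the colimit,
`Φ_K,φ := toTower K ∘ ᵗV_ℓ(φ) : (V_ℓ B)^∨ → H¹_ét(A_∞ ⊗_E Ē, ℚ_ℓ)`, is `Γ_E`-EQUIVARIANT for the contragredient `ρ_B^∨` on the
source and `towerRep` on the target (`towerRep_comp_toTower_dualMap`); hence every eigen-relation `(1 ⊗ ρ_B^∨(σ)) f = c • f` on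
`R ⊗ (V_ℓ B)^∨` (any commutative `ℚ_ℓ`-algebra `R`, e.g. `ℚ_ℓ^{ac}`) is transported to
`(1 ⊗ towerRep σ) (Φ f) = c • Φ f` in `R ⊗ H¹_ét(A_∞)` (`towerRep_baseChange_eq_smul_of_dual_eq_smul`).

DICTIONARY LINE (cell `hodgecm-mathlib`, crux `HLiu418` = stmt-HodgeConjecture-24832, d6 HOME card / census
`CENSUS-D6-CM-road.A-p04g13.md` §3 (J3)): composed with ★ `ComplexMultiplication.IsCMTypeRealisationOver.dual_rationalTateRep_eigenline_eventually_along`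
(arithmetic Frobenius acts on the `τ`-eigenline of `R ⊗ (V_ℓ B₀)^∨` of a CM structure `(B₀, ι₀)` by `(ι′ (χ_τ(ϖ_v)))⁻¹`), this
gives the CM step of [Liu2021] Thm. D.6 (1) (§D.4, FJcycle.tex l. 5626–5628: «a surjective homomorphism `φ : A_K → B` … `B₀` has
complex multiplications … `μ̃` is the associated CM character of `B₀`») in the registered currency of `thmD6OneCurveCUF`
(`(sec42DataGS …).towerRep ℓ σ`, base-changed to `ℚ_ℓ^{ac}`, INVERSE uniformiser value): for every class of the form `Φ_{K,φ} f`
with `f` on the eigenline, `(1 ⊗ towerRep σ)(Φ f) = (ι′ (χ_τ(ϖ_v)))⁻¹ • Φ f`.  What remains for a d6 line is (J1): that the values of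
`f′ ∈ omegaHom …` ARE such classes (multiplicity one, [Liu2021] Prop. D.4 (1)) — not addressed here.  The file moves no book
(HC_CM is proved only modulo the 7 printed citations until rung 0 closes).

## References
* [Liu2021] Y. Liu, *Fourier–Jacobi cycles and arithmetic relative trace formula*, Camb. J. Math. 9 (2021): §4.2 l. 2066–2074 (the
  Albanese tower), §4.2 l. 2152–2165 (`H¹_ét(A_∞)` as a `Gal × 𝔾`-module), App. D §D.4 l. 5626–5628 (proof of Thm. D.6 (1)).
* [SerreTate1968] J.-P. Serre, J. Tate, *Good reduction of abelian varieties*, Ann. of Math. 88 (1968), §1 (functoriality of `V_ℓ`).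
-/

set_option autoImplicit false

noncomputable section

open CategoryTheory NumberField
open scoped TensorProduct

namespace Literature.NumberTheory.Automorphic.Liu2021.AppendixC

open Literature.AlgebraicGeometry.Motives (AbelianVariety)
open Literature.AlgebraicGeometry.Motives.AbelianVariety (rationalTateModuleMap rationalTateRep_rationalTateModuleMap)

variable {F E : Type} [Field F] [NumberField F] [IsTotallyReal F] [Field E] [NumberField E] [Algebra F E]
  [IsTotallyComplex E] [Algebra.IsQuadraticExtension F E]
variable {P5 : PropC5Data F E} {isotropicAt : ℕ → Prop}

namespace Sec42Data

variable (C : Sec42Data P5 isotropicAt) (ℓ : ℕ) [Fact ℓ.Prime]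

/-- **`ᵗV_ℓ(φ)` intertwines the contragredients**: for `φ : A_K ⟶ B` over `E` and `σ ∈ Γ_E`,
`ρ_{A_K}^∨(σ) ∘ ᵗV_ℓ(φ) = ᵗV_ℓ(φ) ∘ ρ_B^∨(σ)` on linear forms (`V_ℓ φ` is `Γ_E`-equivariant, ★ `rationalTateRep_rationalTateModuleMap`,
dualised; level-`K` form, `etaleH1Rep = (rationalTateRep).dual`). [cite: Liu2021, §4.2 (FJcycle.tex l. 2158–2160)] [cite: SerreTate1968, §1] -/
theorem etaleH1Rep_dualMap (K : C5.SmallLevel C.S.K₀) {B : AbelianVariety E} (φ : C.A K ⟶ B)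
    (σ : Field.absoluteGaloisGroup E) (f : Module.Dual ℚ_[ℓ] (B.rationalTateModule ℓ)) :
    C.etaleH1Rep ℓ K σ ((rationalTateModuleMap ℓ φ).dualMap f) =
      (rationalTateModuleMap ℓ φ).dualMap ((B.rationalTateRep ℓ).dual σ f) := by
  apply LinearMap.ext
  intro v
  rw [etaleH1Rep_apply]
  simp only [LinearMap.dualMap_apply, Representation.dual_apply, Module.Dual.transpose_apply, LinearMap.coe_comp,
    Function.comp_apply, rationalTateRep_rationalTateModuleMap]

/-- **`Φ_{K,φ} := toTower K ∘ ᵗV_ℓ(φ) : (V_ℓ B)^∨ → H¹_ét(A_∞)` is `Γ_E`-equivariant**: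
`towerRep σ ∘ Φ = Φ ∘ ρ_B^∨(σ)` (★ `towerRep_toTower` + `etaleH1Rep_dualMap`). [cite: Liu2021, §4.2 (FJcycle.tex l. 2158–2160)] -/
theorem towerRep_comp_toTower_dualMap (K : C5.SmallLevel C.S.K₀) {B : AbelianVariety E} (φ : C.A K ⟶ B)
    (σ : Field.absoluteGaloisGroup E) :
    C.towerRep ℓ σ ∘ₗ (C.toTower ℓ K ∘ₗ (rationalTateModuleMap ℓ φ).dualMap) =
      (C.toTower ℓ K ∘ₗ (rationalTateModuleMap ℓ φ).dualMap) ∘ₗ (B.rationalTateRep ℓ).dual σ := by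
  apply LinearMap.ext
  intro f
  simp only [LinearMap.coe_comp, Function.comp_apply]
  rw [towerRep_toTower, etaleH1Rep_dualMap]

/-- **Transport of an eigen-relation into the tower.**  For any commutative `ℚ_ℓ`-algebra `R` (e.g. `ℚ_ℓ^{ac}`), `σ ∈ Γ_E`,
`c ∈ R` and `f ∈ R ⊗ (V_ℓ B)^∨` with `(1 ⊗ ρ_B^∨(σ)) f = c • f`: the class `(1 ⊗ Φ_{K,φ}) f ∈ R ⊗ H¹_ét(A_∞)` satisfies
`(1 ⊗ towerRep σ) ((1 ⊗ Φ) f) = c • (1 ⊗ Φ) f`.  With `c = (ι′ (χ_τ(ϖ_v)))⁻¹` from ★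
`IsCMTypeRealisationOver.dual_rationalTateRep_eigenline_eventually_along` this is the CM step of [Liu2021] Thm. D.6 (1) in
`towerRep` currency. [cite: Liu2021, §4.2 (FJcycle.tex l. 2158–2165) and App. D §D.4 (l. 5626–5628)] -/
theorem towerRep_baseChange_eq_smul_of_dual_eq_smul (K : C5.SmallLevel C.S.K₀) {B : AbelianVariety E} (φ : C.A K ⟶ B)
    (σ : Field.absoluteGaloisGroup E) (R : Type) [CommRing R] [Algebra ℚ_[ℓ] R] (c : R)
    (f : R ⊗[ℚ_[ℓ]] Module.Dual ℚ_[ℓ] (B.rationalTateModule ℓ))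
    (hf : ((B.rationalTateRep ℓ).dual σ).baseChange R f = c • f) :
    (C.towerRep ℓ σ).baseChange R
        ((C.toTower ℓ K ∘ₗ (rationalTateModuleMap ℓ φ).dualMap).baseChange R f) =
      c • (C.toTower ℓ K ∘ₗ (rationalTateModuleMap ℓ φ).dualMap).baseChange R f := by
  have key := congrArg (fun (L : Module.Dual ℚ_[ℓ] (B.rationalTateModule ℓ) →ₗ[ℚ_[ℓ]] C.etaleH1Tower ℓ) =>
    (L.baseChange R) f) (C.towerRep_comp_toTower_dualMap ℓ K φ σ)
  simp only [LinearMap.baseChange_comp, LinearMap.comp_apply] at key ⊢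
  rw [key, hf, map_smul, map_smul]

/-- Pure-tensor form of the transport: for `f₀ ∈ (V_ℓ B)^∨` with `ρ_B^∨(σ) f₀` arbitrary and `r ∈ R`,
`(1 ⊗ towerRep σ) (r ⊗ Φ f₀) = r ⊗ Φ (ρ_B^∨(σ) f₀)` (unfolding of `towerRep_comp_toTower_dualMap` on `r ⊗ₜ f₀`; the bookkeeping
a consumer needs to move between `R ⊗ H¹_ét(A_K)`-level and tower-level statements). [cite: Liu2021, §4.2 (FJcycle.tex l. 2158–2160)] -/
theorem towerRep_baseChange_tmul_toTower_dualMap (K : C5.SmallLevel C.S.K₀) {B : AbelianVariety E} (φ : C.A K ⟶ B)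
    (σ : Field.absoluteGaloisGroup E) (R : Type) [CommRing R] [Algebra ℚ_[ℓ] R] (r : R)
    (f₀ : Module.Dual ℚ_[ℓ] (B.rationalTateModule ℓ)) :
    (C.towerRep ℓ σ).baseChange R (r ⊗ₜ[ℚ_[ℓ]] C.toTower ℓ K ((rationalTateModuleMap ℓ φ).dualMap f₀)) =
      r ⊗ₜ[ℚ_[ℓ]] C.toTower ℓ K ((rationalTateModuleMap ℓ φ).dualMap ((B.rationalTateRep ℓ).dual σ f₀)) := by
  rw [LinearMap.baseChange_tmul, towerRep_toTower, etaleH1Rep_dualMap]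

end Sec42Data

end Literature.NumberTheory.Automorphic.Liu2021.AppendixC

end
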